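import Summits.CriticalPhenomena.PercolationContinuityZ3.Theorems.PercNearOneGluingNoHeavyLowerTailHullPortTANSetMarkerDominance
import HarnessLib

/-!
# `NoHeavyLowerTail` (stmt-CriticalPhenomena-4575) — the PLAIN set-observer marker dominance lemma (`P1**-PLAIN-set`)

Support file (prover `prim-cplus-coupling`, gen 16; `--supports stmt-CriticalPhenomena-4575`); no definitions, named facts
or sorries.  The coupling seat's atom `P1**-PLAIN-set` (cell memo A5-COUPLING-gen13.md §2(v), gen15 §6.3, gen16): for the
owner `s`, an avoided set `X`, a marker `y ≠ s`, an observer SET `N` and every monotone `F` of the open edge cluster of `s`,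
with `D = {s ↮ X}`, `Y = {s ↔ y}`, `O = {s ↔ N}` (NO separation of `N` from `X`, this is the difference with
`HullPort.setMarkerDominanceAvoid`) and `cov_D(F, 1_E) = μ(D) ∫_{D∩E} F − (∫_D F) μ(D ∩ E)`:
`μ(y ↮ s,X; y ↔ N; N ↮ s,X) · cov_D(F, 1_Y) ≤ μ(y ↮ s,X) · cov_D(F, 1_O)`.
Proof: prim-lit-3's reduction theorem `BHK2006_clusterConditionalCov_nonneg_of_within_of_forall_nondegenerate` with the
`C_s`-MEASURABLE test function `h_p = b_p·1{C_s ∈ hitN s N} − a^N_p·1{y ∈ V(C_s)}`; its hypothesis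
(`ClubPsi.withinD_plain_nonneg`) is bounded below termwise by prim-hp-7's `Q^N = taQN ≥ 0` (`HullPort.taQN_nonneg`) through
`HullPort.setObs_condCov_ge` (the set z-free core in `G − cut_X(ω)`, used for EVERY cut: the factor `1{N ↮ X}` is dropped
because `Cov(g, 1{s ↔ N} | C_X) ≥ 0` by Harris).  The vertex-cluster corollary `ClubPsi.setPlainMarkerDominance_cov` at
`(s, X) = (z, {x})` is the atom through which CLUB-Ψ (prim-lf-3's quantitative glued Question 9) follows (gen16 memo).
[cite: VandenbergHaggstromKahn2005, Thm. 1.3 (p. 6), Thms 1.4–1.5 (p. 7), §2.1 pp. 9–13]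
[cite: KozmaNitzan2024, §5.1 (pp. 31–32), Question 9 (p. 36)] [cite: Gladkov2024, Thm. 3.2 (via `HullPort.Pv_holds`)]
-/

noncomputable section

namespace Summit.CriticalPhenomena.PercolationContinuityZ3.Theorems

open MeasureTheory Set Literature.Probability.LatticeModels Literature.Probability.Percolation
open scoped Classical

variable {V : Type*}

namespace ClubPsi

open HullPort LonePortSum LonePortSumGeneral BHK2006 DecisionTree KNPreFKG

section SetPlain

variable [Fintype V]

/-- **Harris in `G − cut_X(ω)`**: `Cov(g(C_s), 1{C_s ∈ hitN s N} | C_X = C_X(ω)) ≥ 0` for monotone `g ≥ 0`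
(the one-step conditional covariance of BHK's chain for the zeroed weights is an honest covariance of two increasing
functions). [cite: VandenbergHaggstromKahn2005, §1 p. 6 (Harris), §2.1 Lemma 2.4 (p. 10)] -/
theorem condCov_hitN_nonneg (p : Sym2 V → unitInterval) (s : V) (N X : Set V)
    (g : Set (Sym2 V) → ℝ) (hg : Monotone g) (hg0 : ∀ C, 0 ≤ g C) (ω : Set (Sym2 V)) :
    0 ≤ condCov (fun e => (p e : ℝ)) {s} X g (ind (hitN s N)) (setCl ω X) := by
  classical
  set w : Sym2 V → ℝ := fun e => (p e : ℝ) with hw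
  set B₀ : Set (Sym2 V) := cut X ω with hB₀
  set q : Sym2 V → unitInterval := fun e => if e ∈ B₀ then 0 else p e with hq
  set wq : Sym2 V → ℝ := fun e => (q e : ℝ) with hwq
  have hwq' : wq = fun i => if i ∈ B₀ then 0 else w i := by
    funext e
    simp only [hwq, hq, hw]
    split_ifs <;> rfl
  have hq0 : ∀ e, 0 ≤ wq e := fun e => (q e).2.1
  have hq1 : ∀ e, wq e ≤ 1 := fun e => (q e).2.2
  have hmq : ∑ η, weight wq η = 1 := by
    have h1 := integral_prodBernoulli_eq_sum q fun _ => (1 : ℝ)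
    simp only [integral_const, probReal_univ, smul_eq_mul, mul_one] at h1
    exact h1.symm
  have hdel : ∀ φ : Set (Sym2 V) → ℝ, delE w B₀ φ = ∑ η, weight wq η * φ η := by
    intro φ
    rw [delE, sum_weight_mul_comp_sdiff w B₀ φ, hwq']
  have hbar : barOf X (setCl ω X) = B₀ := barOf_setCl_eq ω X
  have hcc : condCov w {s} X g (ind (hitN s N)) (setCl ω X) =
      (∑ η, weight wq η * (g (openEdgeCluster η s) * ind (connS N s) η)) -
        (∑ η, weight wq η * g (openEdgeCluster η s)) * ∑ η, weight wq η * ind (connS N s) η := by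
    have e1 : condS w {s} X (fun A => g A * ind (hitN s N) A) (setCl ω X) =
        delE w B₀ (fun η => g (openEdgeCluster η s) * ind (connS N s) η) := by
      simp only [condS, halfS, delE, hbar, setCl_singleton, ind_hitN_openEdgeCluster]
    have e2 : condS w {s} X g (setCl ω X) = delE w B₀ (fun η => g (openEdgeCluster η s)) := by
      simp only [condS, halfS, delE, hbar, setCl_singleton]
    have e3 : condS w {s} X (ind (hitN s N)) (setCl ω X) = delE w B₀ (fun η => ind (connS N s) η) := by
      simp only [condS, halfS, delE, hbar, setCl_singleton, ind_hitN_openEdgeCluster]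
    rw [condCov, e1, e2, e3, hdel, hdel, hdel]
  have hgm : Monotone fun η : Set (Sym2 V) => g (openEdgeCluster η s) := fun η η' h => hg (openEdgeCluster_mono h s)
  have hcm : Monotone fun η : Set (Sym2 V) => ind (connS N s) η := by
    intro η η' hle
    have hup : IsUpperSet (connS N s : Set (Set (Sym2 V))) := by
      intro a b hab ha
      obtain ⟨n, hn, hr⟩ := ha
      exact ⟨n, hn, hr.mono (openGraph_le hab)⟩
    show ind (connS N s) η ≤ ind (connS N s) η'
    by_cases h1 : η ∈ connS N s
    · rw [ind_of_mem h1, ind_of_mem (hup hle h1)]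
    · rw [ind_of_not_mem h1]; exact ind_nonneg _ _
  have hH := harris hq0 hq1 (fun η => hg0 _) (fun η => ind_nonneg _ _) hgm hcm
  rw [hmq, one_mul] at hH
  rw [hcc]; linarith

/-- **The hypothesis of the reduction theorem for the PLAIN test function.**  For all weights `< 1`, `s ≠ y`, every
avoided set `X`, observer set `N` and monotone `g ≥ 0`, with `D = {s ↮ X}`, `b = μ(y ↮ s, X)` (`tab`),
`a^N = μ(y ↮ s,X; y ↔ N; N ↮ s,X)` (`taaN`) and the `C_s`-measurable test `h = b · 1{· ∈ hitN s N} − a^N · 1{y ∈ V(·)}`: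
`withinD(g, h) = Σ_ω w(ω) 1_D(ω) Cov(g, h | C_X = C_X(ω)) ≥ Q^N = taQN ≥ 0`, termwise by `HullPort.setObs_condCov_ge`
(and `condCov_hitN_nonneg` to drop `1{N ↮ X}`), `HullPort.condCov_chi_eq_taC`, `HullPort.taQN_nonneg`.
(cell memo prim-cplus-coupling A5-COUPLING-gen16.md) [cite: VandenbergHaggstromKahn2005, §2.1 pp. 10–13 — corollaries] -/
theorem withinD_plain_nonneg (p : Sym2 V → unitInterval) (hp : ∀ e, (p e : ℝ) < 1) (s y : V) (hsy : s ≠ y)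
    (N X : Set V) (g : Set (Sym2 V) → ℝ) (hg : Monotone g) (hg0 : ∀ C, 0 ≤ g C) :
    0 ≤ withinD (fun e => (p e : ℝ)) {s} X (avoidEv s X) g
      (fun A => tab (fun e => (p e : ℝ)) s y X * ind (hitN s N) A -
        taaN (fun e => (p e : ℝ)) s y N X * (ind {A : Set (Sym2 V) | y = s ∨ ∃ e ∈ A, y ∈ e}) A) := by
  classical
  have hw0 : ∀ e, 0 ≤ (fun e => (p e : ℝ)) e := fun e => (p e).2.1
  have hw1 : ∀ e, (fun e => (p e : ℝ)) e ≤ 1 := fun e => (p e).2.2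
  have hcE0 : 0 ≤ tab (fun e => (p e : ℝ)) s y X :=
    Finset.sum_nonneg fun ω _ => mul_nonneg (weight_nonneg hw0 hw1 ω) (ind_nonneg _ _)
  -- bilinearity of `condCov` in the test function
  have hlin : ∀ B : Set (Sym2 V), condCov (fun e => (p e : ℝ)) {s} X g
      (fun A => tab (fun e => (p e : ℝ)) s y X * ind (hitN s N) A -
        taaN (fun e => (p e : ℝ)) s y N X * (ind {A : Set (Sym2 V) | y = s ∨ ∃ e ∈ A, y ∈ e}) A) B =
      tab (fun e => (p e : ℝ)) s y X * condCov (fun e => (p e : ℝ)) {s} X g (ind (hitN s N)) B -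
        taaN (fun e => (p e : ℝ)) s y N X *
          condCov (fun e => (p e : ℝ)) {s} X g (ind {A : Set (Sym2 V) | y = s ∨ ∃ e ∈ A, y ∈ e}) B := by
    intro B
    simp only [condCov, condS]
    rw [show (∑ η, weight (fun e => (p e : ℝ)) η * (g (halfS {s} X B η) *
          (tab (fun e => (p e : ℝ)) s y X * ind (hitN s N) (halfS {s} X B η) -
            taaN (fun e => (p e : ℝ)) s y N X * ind {A : Set (Sym2 V) | y = s ∨ ∃ e ∈ A, y ∈ e} (halfS {s} X B η)))) =
        tab (fun e => (p e : ℝ)) s y X * ∑ η, weight (fun e => (p e : ℝ)) η * (g (halfS {s} X B η) * ind (hitN s N) (halfS {s} X B η)) -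
          taaN (fun e => (p e : ℝ)) s y N X * ∑ η, weight (fun e => (p e : ℝ)) η *
            (g (halfS {s} X B η) * ind {A : Set (Sym2 V) | y = s ∨ ∃ e ∈ A, y ∈ e} (halfS {s} X B η)) by
      rw [Finset.mul_sum, Finset.mul_sum, ← Finset.sum_sub_distrib]
      exact Finset.sum_congr rfl fun η _ => by ring]
    rw [show (∑ η, weight (fun e => (p e : ℝ)) η *
          (tab (fun e => (p e : ℝ)) s y X * ind (hitN s N) (halfS {s} X B η) -
            taaN (fun e => (p e : ℝ)) s y N X * ind {A : Set (Sym2 V) | y = s ∨ ∃ e ∈ A, y ∈ e} (halfS {s} X B η))) =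
        tab (fun e => (p e : ℝ)) s y X * ∑ η, weight (fun e => (p e : ℝ)) η * ind (hitN s N) (halfS {s} X B η) -
          taaN (fun e => (p e : ℝ)) s y N X * ∑ η, weight (fun e => (p e : ℝ)) η *
            ind {A : Set (Sym2 V) | y = s ∨ ∃ e ∈ A, y ∈ e} (halfS {s} X B η) by
      rw [Finset.mul_sum, Finset.mul_sum, ← Finset.sum_sub_distrib]
      exact Finset.sum_congr rfl fun η _ => by ring]
    ring
  -- termwise lower bound
  have hterm : ∀ ω : Set (Sym2 V),
      tab (fun e => (p e : ℝ)) s y X * (taNWN (fun e => (p e : ℝ)) s y N X ω / taN (fun e => (p e : ℝ)) s y X ω *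
          taC (fun e => (p e : ℝ)) s y X g ω) -
        taaN (fun e => (p e : ℝ)) s y N X * taC (fun e => (p e : ℝ)) s y X g ω ≤
      condCov (fun e => (p e : ℝ)) {s} X g
        (fun A => tab (fun e => (p e : ℝ)) s y X * ind (hitN s N) A -
          taaN (fun e => (p e : ℝ)) s y N X * (ind {A : Set (Sym2 V) | y = s ∨ ∃ e ∈ A, y ∈ e}) A) (setCl ω X) := by
    intro ω
    rw [hlin, condCov_chi_eq_taC (fun e => (p e : ℝ)) s y X g ω]
    have h1 := setObs_condCov_ge p s y hsy N X g hg hg0 ω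
    have h2 := condCov_hitN_nonneg p s N X g hg hg0 ω
    have h3 : ind (missN N X) (setCl ω X) * condCov (fun e => (p e : ℝ)) {s} X g (ind (hitN s N)) (setCl ω X) ≤
        condCov (fun e => (p e : ℝ)) {s} X g (ind (hitN s N)) (setCl ω X) := by
      by_cases hm : setCl ω X ∈ missN N X
      · rw [ind_of_mem hm, one_mul]
      · rw [ind_of_not_mem hm, zero_mul]; exact h2
    have h4 := mul_le_mul_of_nonneg_left (h1.trans h3) hcE0
    linarith
  -- sum up: `withinD ≥ taQN ≥ 0`
  have eQ : taQN (fun e => (p e : ℝ)) s y N X g = ∑ ω, weight (fun e => (p e : ℝ)) ω *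
      ((tab (fun e => (p e : ℝ)) s y X * (taNWN (fun e => (p e : ℝ)) s y N X ω / taN (fun e => (p e : ℝ)) s y X ω *
          taC (fun e => (p e : ℝ)) s y X g ω) -
        taaN (fun e => (p e : ℝ)) s y N X * taC (fun e => (p e : ℝ)) s y X g ω) * ind (avoidEv s X) ω) := by
    have e1 : taAN (fun e => (p e : ℝ)) s y N X g * tab (fun e => (p e : ℝ)) s y X = ∑ ω, weight (fun e => (p e : ℝ)) ω *
        (tab (fun e => (p e : ℝ)) s y X * (taNWN (fun e => (p e : ℝ)) s y N X ω / taN (fun e => (p e : ℝ)) s y X ω *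
          taC (fun e => (p e : ℝ)) s y X g ω) * ind (avoidEv s X) ω) := by
      rw [taAN, Finset.sum_mul]
      exact Finset.sum_congr rfl fun ω _ => by ring
    have e2 : taaN (fun e => (p e : ℝ)) s y N X * taB (fun e => (p e : ℝ)) s y X g = ∑ ω, weight (fun e => (p e : ℝ)) ω *
        (taaN (fun e => (p e : ℝ)) s y N X * taC (fun e => (p e : ℝ)) s y X g ω * ind (avoidEv s X) ω) := by
      rw [taB, Finset.mul_sum]
      exact Finset.sum_congr rfl fun ω _ => by ring
    rw [taQN, e1, e2, ← Finset.sum_sub_distrib]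
    exact Finset.sum_congr rfl fun ω _ => by ring
  have hQ0 : 0 ≤ taQN (fun e => (p e : ℝ)) s y N X g := taQN_nonneg s y hsy N g hg hg0 p hp X
  rw [withinD]
  refine le_trans hQ0 ?_
  rw [eQ]
  refine Finset.sum_le_sum fun ω _ => mul_le_mul_of_nonneg_left ?_ (weight_nonneg hw0 hw1 ω)
  exact mul_le_mul_of_nonneg_right (hterm ω) (ind_nonneg _ _)

/-- **The PLAIN set-observer marker dominance lemma** (`P1**-PLAIN-set`, with an avoided set).  Owner `s`, avoided
set `X`, marker `y ≠ s`, observer set `N`, `F` monotone on the open edge cluster of `s`; `D = {s ↮ X}`, `Y = {s ↔ y}`,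
`O = {s ↔ N}`:
`μ(y ↮ s,X; y ↔ N; N ↮ s,X) · [μ(D) ∫_{D∩Y} F − (∫_D F) μ(D∩Y)] ≤ μ(y ↮ s,X) · [μ(D) ∫_{D∩O} F − (∫_D F) μ(D∩O)]`.
(coupling seat census P1SS-PLAIN 0 / 3,820, cell memos prim-cplus-coupling A5-COUPLING-gen13.md §2(v), gen16; proof along
prim-hp-7's `T_A` induction with a `C_s`-measurable test function)
[cite: VandenbergHaggstromKahn2005, Thm. 1.3 (p. 6), Thms 1.4–1.5 (p. 7), §2.1 pp. 9–13 — corollaries]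
[cite: KozmaNitzan2024, Question 9 (p. 36)] -/
theorem setPlainMarkerDominanceAvoid (w : Sym2 V → unitInterval) (s y : V) (N X : Set V) (hsy : s ≠ y)
    (F : Set (Sym2 V) → ℝ) (hF : Monotone F) :
    (prodBernoulli w).real (avoidEv y (insert s X) ∩ (connS N y ∩ sepEv N (insert s X))) *
        ((prodBernoulli w).real (avoidEv s X) *
            (∫ ω in avoidEv s X ∩ openConn s y, F (openEdgeCluster ω s) ∂(prodBernoulli w)) -
          (∫ ω in avoidEv s X, F (openEdgeCluster ω s) ∂(prodBernoulli w)) *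
            (prodBernoulli w).real (avoidEv s X ∩ openConn s y)) ≤
      (prodBernoulli w).real (avoidEv y (insert s X)) *
        ((prodBernoulli w).real (avoidEv s X) *
            (∫ ω in avoidEv s X ∩ connS N s, F (openEdgeCluster ω s) ∂(prodBernoulli w)) -
          (∫ ω in avoidEv s X, F (openEdgeCluster ω s) ∂(prodBernoulli w)) *
            (prodBernoulli w).real (avoidEv s X ∩ connS N s)) := by
  classical
  have hDeq : {ω : BondConfig V | ∀ x ∈ X, ¬ (openGraph ω).Reachable s x} = avoidEv s X := rfl
  -- the test functions `h_q = b_q 1{hitN} − a^N_q χ_y`, continuous in the weights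
  set h : (Sym2 V → unitInterval) → Set (Sym2 V) → ℝ := fun q A =>
    tab (fun e => (q e : ℝ)) s y X * ind (hitN s N) A -
      taaN (fun e => (q e : ℝ)) s y N X * ind {A : Set (Sym2 V) | y = s ∨ ∃ e ∈ A, y ∈ e} A with hh
  have hcont : ∀ C, Continuous fun q => h q C := by
    intro C
    simp only [hh, tab, taaN]
    refine Continuous.sub (Continuous.mul ?_ continuous_const) (Continuous.mul ?_ continuous_const)
    · exact continuous_finsetSum _ fun ω _ => (continuous_weight ω).mul continuous_const
    · exact continuous_finsetSum _ fun ω _ => (continuous_weight ω).mul continuous_const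
  -- the hypothesis of the reduction theorem
  have hR : ∀ p : Sym2 V → unitInterval, (∀ e, 0 < p e ∧ p e < 1) →
      ∀ g : Set (Sym2 V) → ℝ, Monotone g → (∀ C, 0 ≤ g C) →
      0 ≤ ∫ ω in {ω : BondConfig V | ∀ x ∈ X, ¬ (openGraph ω).Reachable s x},
        ((∫ η, g (openEdgeCluster (η \ {e | ∃ v ∈ e, ∃ x ∈ X, (openGraph ω).Reachable x v}) s) *
              h p (openEdgeCluster (η \ {e | ∃ v ∈ e, ∃ x ∈ X, (openGraph ω).Reachable x v}) s)
            ∂(prodBernoulli p)) -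
          (∫ η, g (openEdgeCluster (η \ {e | ∃ v ∈ e, ∃ x ∈ X, (openGraph ω).Reachable x v}) s)
            ∂(prodBernoulli p)) *
          (∫ η, h p (openEdgeCluster (η \ {e | ∃ v ∈ e, ∃ x ∈ X, (openGraph ω).Reachable x v}) s)
            ∂(prodBernoulli p))) ∂(prodBernoulli p) := by
    intro p hp g hg hg0
    have hp1 : ∀ e, (p e : ℝ) < 1 := fun e => by exact_mod_cast (hp e).2
    have hwithin : ∫ ω in {ω : BondConfig V | ∀ x ∈ X, ¬ (openGraph ω).Reachable s x},
        ((∫ η, g (openEdgeCluster (η \ {e | ∃ v ∈ e, ∃ x ∈ X, (openGraph ω).Reachable x v}) s) *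
              h p (openEdgeCluster (η \ {e | ∃ v ∈ e, ∃ x ∈ X, (openGraph ω).Reachable x v}) s)
            ∂(prodBernoulli p)) -
          (∫ η, g (openEdgeCluster (η \ {e | ∃ v ∈ e, ∃ x ∈ X, (openGraph ω).Reachable x v}) s)
            ∂(prodBernoulli p)) *
          (∫ η, h p (openEdgeCluster (η \ {e | ∃ v ∈ e, ∃ x ∈ X, (openGraph ω).Reachable x v}) s)
            ∂(prodBernoulli p))) ∂(prodBernoulli p) =
        withinD (fun e => (p e : ℝ)) {s} X (avoidEv s X) g (h p) := by
      rw [withinD, hDeq, setIntegral_eq_sum p (avoidEv s X)]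
      refine Finset.sum_congr rfl fun ω _ => ?_
      rw [condCov, integral_sdiff_eq_condS p s X (fun A => g A * h p A) ω, integral_sdiff_eq_condS p s X g ω,
        integral_sdiff_eq_condS p s X (h p) ω]
    rw [hwithin]
    exact withinD_plain_nonneg p hp1 s y hsy N X g hg hg0
  have main := BHK2006_clusterConditionalCov_nonneg_of_within_of_forall_nondegenerate w s X h hcont hR F hF
  rw [hDeq] at main
  -- unfold `h_w` inside the two integrals (everything as finite sums)
  have hcE : tab (fun e => (w e : ℝ)) s y X = (prodBernoulli w).real (avoidEv y (insert s X)) := by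
    rw [measureReal_eq_sum]; rfl
  have hca : taaN (fun e => (w e : ℝ)) s y N X =
      (prodBernoulli w).real (avoidEv y (insert s X) ∩ (connS N y ∩ sepEv N (insert s X))) := by
    rw [measureReal_eq_sum]; rfl
  have i1 : ∑ ω, weight (fun e => (w e : ℝ)) ω * (F (openEdgeCluster ω s) *
      ind (hitN s N) (openEdgeCluster ω s) * ind (avoidEv s X) ω) =
      ∫ ω in avoidEv s X ∩ connS N s, F (openEdgeCluster ω s) ∂(prodBernoulli w) := by
    rw [setIntegral_eq_sum w (avoidEv s X ∩ connS N s)]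
    refine Finset.sum_congr rfl fun ω _ => ?_
    simp only [ind_hitN_openEdgeCluster, ind_inter]; ring
  have i2 : ∑ ω, weight (fun e => (w e : ℝ)) ω * (ind (hitN s N) (openEdgeCluster ω s) * ind (avoidEv s X) ω) =
      (prodBernoulli w).real (avoidEv s X ∩ connS N s) := by
    rw [measureReal_eq_sum w (avoidEv s X ∩ connS N s)]
    refine Finset.sum_congr rfl fun ω _ => ?_
    simp only [ind_hitN_openEdgeCluster, ind_inter]; ring
  have i3 : ∑ ω, weight (fun e => (w e : ℝ)) ω * (F (openEdgeCluster ω s) *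
      ind {A : Set (Sym2 V) | y = s ∨ ∃ e ∈ A, y ∈ e} (openEdgeCluster ω s) * ind (avoidEv s X) ω) =
      ∫ ω in avoidEv s X ∩ openConn s y, F (openEdgeCluster ω s) ∂(prodBernoulli w) := by
    rw [setIntegral_eq_sum w (avoidEv s X ∩ openConn s y)]
    refine Finset.sum_congr rfl fun ω _ => ?_
    simp only [ind_chiSet_openEdgeCluster, ind_inter]; ring
  have i4 : ∑ ω, weight (fun e => (w e : ℝ)) ω *
      (ind {A : Set (Sym2 V) | y = s ∨ ∃ e ∈ A, y ∈ e} (openEdgeCluster ω s) * ind (avoidEv s X) ω) =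
      (prodBernoulli w).real (avoidEv s X ∩ openConn s y) := by
    rw [measureReal_eq_sum w (avoidEv s X ∩ openConn s y)]
    refine Finset.sum_congr rfl fun ω _ => ?_
    simp only [ind_chiSet_openEdgeCluster, ind_inter]; ring
  have c1 : ∫ ω in avoidEv s X, F (openEdgeCluster ω s) * h w (openEdgeCluster ω s) ∂(prodBernoulli w) =
      tab (fun e => (w e : ℝ)) s y X *
          (∫ ω in avoidEv s X ∩ connS N s, F (openEdgeCluster ω s) ∂(prodBernoulli w)) -
        taaN (fun e => (w e : ℝ)) s y N X * ∫ ω in avoidEv s X ∩ openConn s y, F (openEdgeCluster ω s) ∂(prodBernoulli w) := by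
    rw [← i1, ← i3, setIntegral_eq_sum w (avoidEv s X), Finset.mul_sum, Finset.mul_sum, ← Finset.sum_sub_distrib]
    refine Finset.sum_congr rfl fun ω _ => ?_
    simp only [hh]
    ring
  have c2 : ∫ ω in avoidEv s X, h w (openEdgeCluster ω s) ∂(prodBernoulli w) =
      tab (fun e => (w e : ℝ)) s y X * (prodBernoulli w).real (avoidEv s X ∩ connS N s) -
        taaN (fun e => (w e : ℝ)) s y N X * (prodBernoulli w).real (avoidEv s X ∩ openConn s y) := by
    rw [← i2, ← i4, setIntegral_eq_sum w (avoidEv s X), Finset.mul_sum, Finset.mul_sum, ← Finset.sum_sub_distrib]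
    refine Finset.sum_congr rfl fun ω _ => ?_
    simp only [hh]
    ring
  rw [c1, c2, hcE, hca] at main
  nlinarith [main, measureReal_nonneg (μ := prodBernoulli w) (s := avoidEv s X)]

omit [Fintype V] in
/-- `{x ↮ z} ∩ {x ↔ N}` written with `avoidEv`/`connS`. [folklore] -/
theorem avoidEv_inter_connS_eq (x z : V) (N : Set V) :
    (avoidEv x ({z} : Set V) ∩ connS N x : Set (Set (Sym2 V))) =
      {ω : BondConfig V | ∃ n ∈ N, (openGraph ω).Reachable x n} ∩ {ω | ¬ (openGraph ω).Reachable x z} := by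
  rw [avoidEv_singleton_eq]
  ext ω
  simp only [connS, Set.mem_inter_iff, Set.mem_setOf_eq]
  constructor
  · rintro ⟨hz, n, hn, hxn⟩
    exact ⟨⟨n, hn, hxn⟩, hz⟩
  · rintro ⟨⟨n, hn, hxn⟩, hz⟩
    exact ⟨hz, n, hn, hxn⟩

/-- **`P1**-PLAIN-set` for the open VERTEX cluster** — `setPlainMarkerDominanceAvoid` at `(s, X) = (x, {z})`: owner `x`
conditioned on `{x ↮ z}`, marker `y ≠ x`, observer set `N`, `F` monotone on vertex sets:
`μ(N ↔ y, N ↮ x, N ↮ z) · cov_{x↮z}(F(C_x), 1{x ↔ y}) ≤ μ(y ↮ x, y ↮ z) · cov_{x↮z}(F(C_x), 1{N ↔ x})`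
(denominator-free covariances on `{x ↮ z}`).  This is the atom of the coupling seat's proof of CLUB-Ψ (gen16 memo: with
`(x, y, z)` here `= (z, y, x)` there). [cite: KozmaNitzan2024, §5.1 (pp. 31–32), Question 9 (p. 36)]
[cite: VandenbergHaggstromKahn2005, Thms 1.3–1.5 (pp. 6–7), §2.1] -/
theorem setPlainMarkerDominance_cov (w : Sym2 V → unitInterval) (x y z : V) (N : Set V) (hxy : x ≠ y)
    (F : Set V → ℝ) (hF : ∀ S T : Set V, S ⊆ T → F S ≤ F T) :
    (prodBernoulli w).real ({ω : BondConfig V | ∃ n ∈ N, (openGraph ω).Reachable y n} ∩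
            ({ω | ∀ n ∈ N, ¬ (openGraph ω).Reachable x n} ∩ {ω | ∀ n ∈ N, ¬ (openGraph ω).Reachable z n})) *
        ((prodBernoulli w).real {ω : BondConfig V | ¬ (openGraph ω).Reachable x z} *
            (∫ ω in openConn x y ∩ {ω | ¬ (openGraph ω).Reachable x z}, F (openCluster ω x) ∂(prodBernoulli w)) -
          (prodBernoulli w).real (openConn x y ∩ {ω | ¬ (openGraph ω).Reachable x z}) *
            ∫ ω in {ω : BondConfig V | ¬ (openGraph ω).Reachable x z}, F (openCluster ω x) ∂(prodBernoulli w)) ≤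
      (prodBernoulli w).real ({ω : BondConfig V | ¬ (openGraph ω).Reachable y x} ∩
          {ω | ¬ (openGraph ω).Reachable y z}) *
        ((prodBernoulli w).real {ω : BondConfig V | ¬ (openGraph ω).Reachable x z} *
            (∫ ω in {ω : BondConfig V | ∃ n ∈ N, (openGraph ω).Reachable x n} ∩
              {ω | ¬ (openGraph ω).Reachable x z}, F (openCluster ω x) ∂(prodBernoulli w)) -
          (prodBernoulli w).real ({ω : BondConfig V | ∃ n ∈ N, (openGraph ω).Reachable x n} ∩
              {ω | ¬ (openGraph ω).Reachable x z}) *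
            ∫ ω in {ω : BondConfig V | ¬ (openGraph ω).Reachable x z}, F (openCluster ω x) ∂(prodBernoulli w)) := by
  have key := setPlainMarkerDominanceAvoid w x y N ({z} : Set V) hxy (fun C => F {a | a = x ∨ ∃ e ∈ C, a ∈ e})
    (monotone_clusterFun x F hF)
  simp only [clusterFun_openEdgeCluster] at key
  rw [taaNEv_pair_eq, avoidEv_pair_eq, avoidEv_inter_connS_eq, avoidEv_singleton_eq, Set.inter_comm _ (openConn x y)]
    at key
  linarith [key]

end SetPlain

end ClubPsi

end Summit.CriticalPhenomena.PercolationContinuityZ3.Theorems
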